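import Summits.CriticalPhenomena.Ising3DConformalLimit.Theorems.SynchronousCouplingRotationJoiningIsotropyDefs
import Summits.CriticalPhenomena.Ising3DConformalLimit.Theorems.SynchronousCouplingRotationJoiningSplittingTransfer
import Summits.CriticalPhenomena.Ising3DConformalLimit.Theorems.SynchronousCouplingJoiningsTransfer
import Summits.CriticalPhenomena.Ising3DConformalLimit.Theorems.SynchronousCouplingRotationJoiningTwoPointToolkit
import Summits.CriticalPhenomena.Ising3DConformalLimit.Theorems.SynchronousCouplingRotationJoiningTiltGeometry
import Summits.CriticalPhenomena.Ising3DConformalLimit.Theorems.SynchronousCouplingRotationJoiningMomentsToTests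
import Summits.CriticalPhenomena.Ising3DConformalLimit.Theorems.SynchronousCouplingRotationJoiningNewmanBlocks
import Summits.CriticalPhenomena.Ising3DConformalLimit.Theorems.SynchronousCouplingRotationJoiningTiltedTransfer
import Summits.CriticalPhenomena.Ising3DConformalLimit.Theorems.SynchronousCouplingRotationJoiningIsotropyTransfer
import HarnessLib

/-!
# Line `SketchIdeator2` (card `rate-from-dilations-splitting`) for the crux `RotationJoining`
(item stmt-CriticalPhenomena-18763, route SynchronousCoupling, rank 3) — lead's working skeleton, RESHAPE 2
(lead `prover-line-stmt-CriticalPhenomena-18763-c1-0`, continuation of lead 0)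

Reshape 1 (lead 0) closed the crux modulo `{DilationJoiningsAxis3 ⇐ 18762, DilationJoiningsTilted, AsymptoticFDDIsotropy}`
(`rotationJoining_of_dilationJoinings_tilted_fddIsotropy`, Theorems/SynchronousCouplingRotationJoiningSplittingTransfer.lean).
Reshape 2 derives the two open-content statements from the route's own OPEN cruxes `DilationJoinings` (stmt-18762) and
`UniformRegularity` (stmt-4658) — the inputs the route's deciding theorem `closes` consumes anyway — through the tree's
funnel `DilationJoinings ∧ UniformRegularity ⇒ BlockLimits ⇒ pinned pointwise limit S` (`Cruxes.JoiningsTransfer.Sketch`) and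
`LimitRotationInvariant_of HRP2Rigidity_of` (items 1980/1979):

`RotationJoining_of : Sig.stub_routeCruxes → Sig.stub_twoPointToolkit → Sig.stub_tiltGeometry → Sig.stub_tiltedTransfer →
 Sig.stub_momentsToTests → Sig.stub_newmanBlocks → Sig.stub_isotropyTransfer → RotationJoining`.

Statements: `Theorems/SynchronousCouplingRotationJoiningIsotropyDefs.lean` (second definitions module of the line) on top
of `Theorems/SynchronousCouplingDefs.lean`.  Stubs of reshape 2:
* `stub_routeCruxes : DilationJoinings ∧ UniformRegularity` — items 18762 ∧ 4658 verbatim, NOT worked in this line;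
* `stub_twoPointToolkit` — `DJ → UR → TwoPointToolkit` (V upper doubling, super-cubic growth; from `TwoPointScaling`);
* `stub_tiltGeometry` — Kozma's bijection `ψ`, tilted cell = `ψ⁻¹` axis cell, decomposition into fine axis cells;
* `stub_tiltedTransfer` — `TwoPointToolkit → TiltGeometry → BallSums → DJ → DilationJoiningsTilted`;
* `stub_momentsToTests` — pure probability (sub-Gaussian moments + asymptotically equal mixed moments ⇒ equal tests);
* `stub_newmanBlocks` — Newman's Gaussian bound for block spins of a critical DLR state;
* `stub_isotropyTransfer` — `… → DJ → UR → AsymptoticFDDIsotropy` (lead).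
Glue (sorry-free): `ballSums_of_uniformRegularity` (landed `stub_ballSumRatio`), `RotationJoining_of`, `RotationJoining_proof`.

Status (end of cycle 1): LANDED `stub_twoPointToolkit` (p165478), `stub_tiltGeometry` (p166138), `stub_momentsToTests`
(p166490, tools p166037), `stub_newmanBlocks` (p165298), `stub_tiltedTransfer` (p167171, tools p166792/p166940),
`stub_isotropyTransfer` (Theorems/SynchronousCouplingRotationJoiningIsotropyTransfer.lean; tools IsotropyLimit p165217,
IsotropyRotation p165576, IsotropyFarField p165950, IsotropyMoments p166171, IsotropyTwoPointSums p166297, IsotropyFourPoint p166571,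
IsotropyConstrainedMoment p166669, IsotropyNearField p166945/p167050, IsotropyTransferTools p169079, IsotropyNearGeneric,
IsotropyNearSmall) — all imported below; the ONLY open stub is `stub_routeCruxes` = the route's cruxes
`DilationJoinings` (stmt-18762) ∧ `UniformRegularity` (stmt-4658): the crux `RotationJoining` is CLOSED MODULO THEM
(`RotationJoining_of : Sig.stub_routeCruxes → RotationJoining`, sorry-free; landed as
`Theorems/SynchronousCouplingRotationJoiningOfRouteCruxes.lean`).
-/

namespace Summit.CriticalPhenomena.Ising3DConformalLimit.Cruxes.RotationJoining.RateSplitting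

open MeasureTheory Literature.Probability.LatticeModels
open Summit.CriticalPhenomena.Ising3DConformalLimit.Theses

noncomputable section

/-- The crux is the registered signature, by `Iff.rfl` (certificate that the line targets the route decl's text). -/
theorem rotationJoining_iff' :
    Summit.CriticalPhenomena.Ising3DConformalLimit.Theses.SynchronousCoupling.RotationJoining ↔
    ∀ μ ∈ isingGibbsMeasures 3 (criticalBeta 3) 0, IsTranslationInvariantMeasure μ → ∃ C θ : ℝ, 0 < θ ∧ ∀ n m : ℕ, 1 ≤ n → ∃ π : MeasureTheory.Measure (SpinConfig (Site 3) × SpinConfig (Site 3)), π.fst = μ ∧ π.snd = μ ∧ ∀ u : Fin 3 → ℤ, (∀ i, |u i| ≤ m) → ∫ q, ((Real.sqrt (∫ σ, (∑ x ∈ (Fintype.piFinset (fun _ : Fin 3 => Finset.Icc (-(2 * ((n:ℤ)) * ((m:ℤ) + 1))) (2 * ((n:ℤ)) * ((m:ℤ) + 1)))).filter (fun x => ∀ i, 0 ≤ Matrix.mulVec !![(2:ℤ), 2, -1; -1, 2, 2; 2, -1, 2] x i ∧ Matrix.mulVec !![(2:ℤ), 2, -1; -1, 2, 2; 2, -1,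 2] x i < 3 * ((n:ℤ))), spinAt x σ) ^ 2 ∂μ))⁻¹ * (∑ x ∈ (Fintype.piFinset (fun _ : Fin 3 => Finset.Icc (-(2 * ((n:ℤ)) * ((m:ℤ) + 1))) (2 * ((n:ℤ)) * ((m:ℤ) + 1)))).filter (fun x => ∀ i, 3 * ((n:ℤ)) * u i ≤ Matrix.mulVec !![(2:ℤ), 2, -1; -1, 2, 2; 2, -1, 2] x i ∧ Matrix.mulVec !![(2:ℤ), 2, -1; -1, 2, 2; 2, -1, 2] x i < 3 * ((n:ℤ)) * (u i + 1)), spinAt x q.1) - (Real.sqrt (∫ σ, (∑ x ∈ Fintype.piFinset (fun _ : Fin 3 => Finset.Ico (0:ℤ) ((n:ℤ))), spinAt x σ) ^ 2 ∂μ))⁻¹ * (∑ x ∈ Fintype.piFinset (fun i : Fin 3 => Finset.Ico ((n:ℤ) * u i) ((n:ℤ) * u i + (n:ℤ))), spinAt x q.2)) ^ 2 ∂π ≤ C * (n : ℝ) ^ (-θ) :=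
  Iff.rfl

/-! ## The stubs of reshape 2 -/

/-- STUB 1 — the route inputs `DilationJoinings ∧ UniformRegularity` (items stmt-18762 ∧ stmt-4658 verbatim). NOT worked in
this line: the crux closes MODULO these two open cruxes of the route. -/
theorem stub_routeCruxes : Sig.stub_routeCruxes := by
  sorry

-- STUB 2 `stub_twoPointToolkit` LANDED (imported).

-- STUB 3 `stub_tiltGeometry` LANDED (imported).

-- STUB 4 `stub_tiltedTransfer` LANDED (imported).

-- STUB 5 `stub_momentsToTests` LANDED (imported).

-- STUB 6 `stub_newmanBlocks` LANDED (imported).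

-- STUB 7 `stub_isotropyTransfer` LANDED (imported).

/-! ## Glue (sorry-free) -/

/-- `UniformRegularity` (item 4658) gives the ball-sum bound `BallSums` (landed `stub_ballSumRatio`, through two-point doubling
`uniformRegularity_iff_doubling`). [folklore] -/
theorem ballSums_of_uniformRegularity (hUR : SynchronousCoupling.UniformRegularity) : BallSums :=
  Cruxes.JoiningsTransfer.Sketch.stub_ballSumRatio
    (Cruxes.ExistsScaleCovariantLimit.TwoHierarchies.ItemMaps.uniformRegularity_iff_doubling.1
      (Cruxes.JoiningsTransfer.Sketch.synchronousCoupling_uniformRegularity_iff.1 hUR))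

/-- **The line (reshape 2).** The open stubs give the crux: the route inputs feed the LANDED toolkit
(`stub_twoPointToolkit`) and ball sums, the two transfers produce `DilationJoiningsTilted` and `AsymptoticFDDIsotropy` (using
the LANDED `stub_tiltGeometry`, `stub_newmanBlocks`, `stub_momentsToTests`), and lead 0's landed composition
`rotationJoining_of_dilationJoinings_tilted_fddIsotropy` (`stub_axis3OfDilationJoinings`, `stub_qualitativeOfFDDIsotropy`,
`stub_rateBootstrap`) concludes. -/
theorem RotationJoining_of :
    Sig.stub_routeCruxes →
      Summit.CriticalPhenomena.Ising3DConformalLimit.Theses.SynchronousCoupling.RotationJoining := by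
  intro h₁
  obtain ⟨hDJ, hUR⟩ := h₁
  have hTK : TwoPointToolkit := stub_twoPointToolkit hDJ hUR
  have hBS : BallSums := ballSums_of_uniformRegularity hUR
  exact rotationJoining_of_dilationJoinings_tilted_fddIsotropy hDJ (stub_tiltedTransfer hTK stub_tiltGeometry hBS hDJ)
    (stub_isotropyTransfer hTK stub_tiltGeometry hBS stub_newmanBlocks stub_momentsToTests hDJ hUR)

/-- **The crux `RotationJoining`** (route `SynchronousCoupling`, stmt-CriticalPhenomena-18763), BY NAME, from the stubs of
the line `SketchIdeator2`, reshape 2. -/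
theorem RotationJoining_proof :
    Summit.CriticalPhenomena.Ising3DConformalLimit.Theses.SynchronousCoupling.RotationJoining :=
  RotationJoining_of stub_routeCruxes

end

end Summit.CriticalPhenomena.Ising3DConformalLimit.Cruxes.RotationJoining.RateSplitting
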